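import Summits.ResolutionOfSingularities.ResolutionOfSingularities.Theorems.UniformComplexityPrimeModelTransferOfFamilyResolution
import Summits.ResolutionOfSingularities.ResolutionOfSingularities.Theorems.UniformComplexityPrimeModelTransferSpecializationGraded
import Summits.ResolutionOfSingularities.ResolutionOfSingularities.Theorems.UniformComplexityCampaignW82FamilyResolutionRungs
import Literature.AlgebraicGeometry.Resolution.BirationalDimensionInequality
import HarnessLib

/-!
# Crux `PrimeModelTransfer` (stmt-ResolutionOfSingularities-8933), door 2 of slot W8.2:
# the family form GRADED BY DIMENSION — `FamilyResolutionDimLe k n` ⇒ resolution in dimension `≤ n`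
# over every algebraically closed `K ⊇ k`, and the graded equivalence

Route `ResolutionOfSingularities/UniformComplexity`. Graded version of
`Theorems/UniformComplexityPrimeModelTransferOfFamilyResolution.lean` (p528212, «⇐» of the family form) for
the OURS grades `CampaignW82.FamilyResolutionDimLe k n` (p531166): the same proof with the dimension
carried along — Nagata (`hasResolution_of_forall_proper_upToDim`, p487796: a dense compactification has the
same dimension), Chow (`IsBirational.topologicalKrullDim_eq_of_isProper`: a proper birational morphism of
integral schemes preserves the dimension) and the field base change `K ⊇ (Frac R)^{alg}`-point
(`topologicalKrullDim_baseChange_eq`, p487796) — and the graded equivalence with resolution in dimension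
`≤ n` over ALL algebraically closed fields of characteristic `p`:

* `hasResolution_of_familyResolutionDimLe` — `FamilyResolutionDimLe k n`, `K ⊇ k` algebraically closed,
  `X / K` integral separated of finite type of dimension `≤ n` ⇒ `Scheme.HasResolution X`;
* `familyResolutionDimLe_of_forall_isAlgClosed` — resolution of the integral separated finite-type schemes
  of dimension `≤ n` over every algebraically closed field of characteristic `p` ⇒ `FamilyResolutionDimLe k n`
  for every `k` of characteristic `p` (spreading theorem `exists_familyResolution_datum`, p529834);
* `forall_isAlgClosed_resUpToDim_iff_familyResolutionDimLe` — **for prime `p` and `n : WithBot ℕ∞`: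
  (resolution in dimension `≤ n` over all algebraically closed fields of characteristic `p`) ↔
  `FamilyResolutionDimLe (AlgebraicClosure (ZMod p)) n`**. The first open grade of the family form,
  `FamilyResolutionDimLe 𝔽̄_p 4`, is thus EXACTLY resolution of `4`-dimensional varieties over algebraically
  closed fields of characteristic `p` (grades `≤ 1` unconditional, `≤ 3` modulo F-02: p531789).

[OURS · LADDER-RESOLUTION L1, slot W8.2 (prime-field / universality transfer), door 2 UniformComplexity]
Theorems over the summit's own route and OURS names; NOT statements of, and attributing nothing to,
Hironaka's 2017 manuscript. AI-written; weaker than expert review. Theses-free. Barrier bookkeeping as in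
p528212 / p529834.

Sources: EGA IV₃ (1966) Thm. 8.8.2 (ii), 8.10.5; B. Conrad, *Deligne's notes on Nagata compactifications*
(2007) Thm. 4.1; U. Görtz, T. Wedhorn, *Algebraic Geometry I* (2020) Prop. 5.38, Prop. 10.75 (1);
H. Matsumura, *Commutative Ring Theory* (1986) Thm. 15.5. [cite: EGAIV3, Thm. 8.8.2 (ii)]
[cite: Conrad2007, Thm. 4.1] [cite: GortzWedhorn2020, Prop. 5.38]
-/

noncomputable section

set_option linter.dupNamespace false -- mandated namespace of this single-conjunct summit

open CategoryTheory CategoryTheory.Limits AlgebraicGeometry TopologicalSpace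
open Literature.AlgebraicGeometry.Resolution

namespace Summit.ResolutionOfSingularities.ResolutionOfSingularities.Theorems.PrimeModelTransfer

open MonoidalCategory CartesianMonoidalCategory
open Literature.AlgebraicGeometry.Limits
open Literature.AlgebraicGeometry.Motives (SchemeOver specOver projectiveSpace)

set_option backward.isDefEq.respectTransparency false

/-! ## Graded: `FamilyResolutionDimLe k n` ⇒ resolution in dimension `≤ n` over algebraically closed `K ⊇ k` -/

/-- **`FamilyResolutionDimLe k n` implies resolution in dimension `≤ n` over every algebraically closed
extension `K` of `k`.** The proof of `hasResolution_of_familyResolution` (p528212) with the dimension carried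
along: Nagata (`hasResolution_of_forall_proper_upToDim`), Chow (`IsBirational.topologicalKrullDim_eq_of_isProper`),
and `dim (X' ×_R (Frac R)^{alg}) = dim (X' ×_R K) = dim Y ≤ n` (`topologicalKrullDim_baseChange_eq` along the
flat surjective `Spec K → Spec (Frac R)^{alg}`). [cite: EGAIV3, Thm. 8.8.2 (ii)] [cite: Conrad2007, Thm. 4.1]
[cite: GortzWedhorn2020, Prop. 5.38] -/
theorem hasResolution_of_familyResolutionDimLe (k K : Type) [Field k] [Field K] [IsAlgClosed K]
    [Algebra k K] (n : WithBot ℕ∞) (hFR : CampaignW82.FamilyResolutionDimLe k n)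
    (X : Scheme.{0}) (f : X ⟶ Spec (.of K)) [IsSeparated f] [LocallyOfFiniteType f]
    [QuasiCompact f] [IsIntegral X] (hX : topologicalKrullDim X ≤ n) : Scheme.HasResolution X := by
  classical
  -- ### Step 0: it suffices to resolve integral PROJECTIVE `K`-schemes of dimension `≤ n` (Nagata + Chow)
  refine hasResolution_of_forall_proper_upToDim K n (fun Y₀ g₀ hg₀ hY₀ hdim₀ => ?_) X f hX
  haveI := hg₀
  haveI := hY₀
  obtain ⟨N, Y, ρ, ι, hY, hι, hρ, -, hw, U, hUd, hUpre, hUiso⟩ :=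
    ChowLemmaRing.chow_proper (R := K) Y₀ g₀
  haveI := hρ
  haveI := hι
  haveI := hY
  let g : Y ⟶ Spec (.of K) := ρ ≫ g₀
  have hproj : ChowLemmaRing.IsProjOver (Over.mk g : SchemeOver K) := ⟨N, Over.homMk ι hw, hι⟩
  haveI : IsLocallyNoetherian Y₀ := LocallyOfFiniteType.isLocallyNoetherian g₀
  have hdimY : topologicalKrullDim Y ≤ n := by
    rw [IsBirational.topologicalKrullDim_eq_of_isProper (f := ρ) ⟨U, hUd, hUpre, hUiso⟩]
    exact hdim₀
  refine Scheme.HasResolution.of_isBirational ρ ⟨U, hUd, hUpre, hUiso⟩ ?_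
  -- ### Step 1: a proper model `F : X' → Spec R` over a finitely generated `k`-subalgebra `R ⊆ K`
  obtain ⟨R, _, _, _, ψ, X', F, π, hψ, hRft, hF, hsq⟩ :=
    exists_isPullback_proper_subalgebra k K g hproj
  haveI := hRft
  haveI := hF
  letI : Algebra R K := ψ.toAlgebra
  haveI : FaithfulSMul R K := (faithfulSMul_iff_algebraMap_injective R K).mpr hψ
  -- ### Step 2: the geometric generic fibre `X' ×_R Spec (Frac R)^alg` is integral
  let L : Type := AlgebraicClosure (FractionRing R)
  haveI : Algebra.IsAlgebraic R (FractionRing R) :=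
    IsLocalization.isAlgebraic (FractionRing R) (nonZeroDivisors R)
  haveI : Algebra.IsAlgebraic R L := Algebra.IsAlgebraic.trans R (FractionRing R) L
  haveI : FaithfulSMul R L := (faithfulSMul_iff_algebraMap_injective R L).mpr (by
    rw [IsScalarTower.algebraMap_eq R (FractionRing R) L]
    exact (algebraMap (FractionRing R) L).injective.comp (IsFractionRing.injective R (FractionRing R)))
  let σ : L →ₐ[R] K := IsAlgClosed.lift
  have hσ : σ.toRingHom.comp (algebraMap R L) = ψ := σ.comp_algebraMap
  let iL : Spec (.of L) ⟶ Spec (.of R) := Spec.map (CommRingCat.ofHom (algebraMap R L))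
  let jσ : Spec (.of K) ⟶ Spec (.of L) := Spec.map (CommRingCat.ofHom σ.toRingHom)
  have hjσ : jσ ≫ iL = Spec.map (CommRingCat.ofHom ψ) := by
    change Spec.map _ ≫ Spec.map _ = _
    rw [← Spec.map_comp, ← CommRingCat.ofHom_comp, hσ]
  let XL : Scheme.{0} := pullback F iL
  let FL : XL ⟶ Spec (.of L) := pullback.snd F iL
  let m : Y ⟶ XL := pullback.lift π (g ≫ jσ) (by rw [Category.assoc, hjσ]; exact hsq.w)
  have hsqm : IsPullback m g FL jσ := by
    have outer : IsPullback (m ≫ pullback.fst F iL) g F (jσ ≫ iL) := by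
      rw [pullback.lift_fst, hjσ]; exact hsq
    exact outer.of_right (pullback.lift_snd _ _ _) (IsPullback.of_hasPullback F iL)
  haveI : Subsingleton ↥(Spec (CommRingCat.of L)) := inferInstanceAs (Subsingleton (PrimeSpectrum L))
  haveI : Subsingleton ↥(Spec (CommRingCat.of K)) := inferInstanceAs (Subsingleton (PrimeSpectrum K))
  haveI : Nonempty ↥(Spec (CommRingCat.of K)) := inferInstanceAs (Nonempty (PrimeSpectrum K))
  haveI : Flat jσ := by
    letI : Algebra L K := σ.toRingHom.toAlgebra
    haveI hflat : Module.Flat L K := inferInstance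
    rw [show jσ = Spec.map (CommRingCat.ofHom (algebraMap L K)) from rfl, Flat.SpecMap_iff,
      CommRingCat.hom_ofHom]
    exact RingHom.flat_algebraMap_iff.mpr hflat
  haveI : Surjective jσ := inferInstance
  haveI : Flat m := MorphismProperty.of_isPullback (P := @Flat) hsqm.flip ‹Flat jσ›
  haveI : Surjective m := MorphismProperty.of_isPullback (P := @Surjective) hsqm.flip ‹Surjective jσ›
  haveI : IsReduced XL := Literature.AlgebraicGeometry.Morphisms.isReduced_of_flat_of_surjective m
  haveI : IrreducibleSpace XL := Function.Surjective.irreducibleSpace m.continuous m.surjective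
  haveI hint : IsIntegral XL := isIntegral_of_irreducibleSpace_of_isReduced XL
  -- the dimension of the geometric generic fibre is that of `Y`
  have hdimL : topologicalKrullDim XL ≤ n := by
    letI : Algebra L K := σ.toRingHom.toAlgebra
    haveI : LocallyOfFiniteType FL := inferInstance
    rw [← topologicalKrullDim_baseChange_eq L K hsqm]
    exact hdimY
  -- ### Step 3: the simultaneous weak resolution over an algebraic finite-type extension `A'`
  obtain ⟨A', _, _, _, hinj, -, halg, 𝒴, G, hG⟩ := hFR R hRft X' F hF hint hdimL
  -- ### Step 4: the `K`-point `R ⊆ K` lifts to `τ : A' → K`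
  haveI : FaithfulSMul R A' := (faithfulSMul_iff_algebraMap_injective R A').mpr hinj
  let τ : A' →ₐ[R] K := IsAlgClosed.lift
  have hτ : τ.toRingHom.comp (algebraMap R A') = ψ := τ.comp_algebraMap
  let ιA : Spec (.of A') ⟶ Spec (.of R) := Spec.map (CommRingCat.ofHom (algebraMap R A'))
  let F' : pullback F ιA ⟶ Spec (.of A') := pullback.snd F ιA
  let cτ : Spec (.of K) ⟶ Spec (.of A') := Spec.map (CommRingCat.ofHom τ.toRingHom)
  have hcτ : cτ ≫ ιA = Spec.map (CommRingCat.ofHom ψ) := by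
    change Spec.map _ ≫ Spec.map _ = _
    rw [← Spec.map_comp, ← CommRingCat.ofHom_comp, hτ]
  -- ### Step 5: the fibre of `G` at `τ` is a weak resolution of `(X' ×_R A') ×_{A'} K ≅ Y`
  obtain ⟨hGp, hreg, W, hWne, hWiso⟩ := hG K τ.toRingHom
  let Xτ : Scheme.{0} := pullback F' cτ
  let Gτ : pullback G (pullback.fst F' cτ) ⟶ Xτ := pullback.snd G (pullback.fst F' cτ)
  haveI : IsProper Gτ := hGp
  haveI : IsIso (Gτ ∣_ W) := hWiso
  let e : Xτ ≅ Y :=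
    pullbackLeftPullbackSndIso F ιA cτ ≪≫ pullback.congrHom rfl hcτ ≪≫ hsq.isoPullback.symm
  haveI : IrreducibleSpace Xτ :=
    Function.Surjective.irreducibleSpace e.inv.continuous e.inv.surjective
  let pτ : Xτ ⟶ Spec (.of K) := pullback.snd F' cτ
  haveI : IsProper pτ := inferInstance
  haveI : LocallyOfFiniteType Gτ := @IsProper.toLocallyOfFiniteType _ _ Gτ hGp
  haveI : UniversallyClosed Gτ := @IsProper.toUniversallyClosed _ _ Gτ hGp
  haveI : QuasiCompact Gτ := inferInstance
  haveI hpτ : IsProper pτ := inferInstance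
  haveI : LocallyOfFiniteType pτ := @IsProper.toLocallyOfFiniteType _ _ pτ hpτ
  haveI : UniversallyClosed pτ := @IsProper.toUniversallyClosed _ _ pτ hpτ
  haveI : QuasiCompact pτ := inferInstance
  haveI : IsNoetherian (pullback G (pullback.fst F' cτ)) := isNoetherian_of_locallyOfFiniteType (Gτ ≫ pτ)
  exact Scheme.HasResolution.of_iso e.hom (hasResolution_of_isIso_morphismRestrict Gτ hreg W hWne)

/-! ## The crux slice from family resolution over the prime model -/



/-- **Graded «⇒»**: resolution of the integral separated finite-type schemes of dimension `≤ n` over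
EVERY algebraically closed field of characteristic `p` gives `FamilyResolutionDimLe k n` for every field
`k` of characteristic `p` (spreading theorem `exists_familyResolution_datum`, p529834, at
`L = (Frac A)^{alg}`). [cite: EGAIV3, Thm. 8.10.5] -/
theorem familyResolutionDimLe_of_forall_isAlgClosed (p : ℕ) [Fact p.Prime] (n : WithBot ℕ∞)
    (h : ∀ (K : Type) [Field K] [CharP K p] [IsAlgClosed K] (X : Scheme.{0}) (f : X ⟶ Spec (.of K)),
      IsSeparated f → LocallyOfFiniteType f → QuasiCompact f → IsIntegral X →
        topologicalKrullDim X ≤ n → Scheme.HasResolution X)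
    (k : Type) [Field k] [CharP k p] : CampaignW82.FamilyResolutionDimLe k n := by
  intro A _ _ _ hAft 𝒳 f hf hint hdim
  haveI := hAft
  haveI := hf
  haveI : IsNoetherianRing A := Algebra.FiniteType.isNoetherianRing k A
  haveI : CharP A p := charP_of_injective_algebraMap (algebraMap k A).injective p
  obtain ⟨halg, hAL⟩ := CampaignW82.algebraicClosure_fractionRing_isAlgebraic_injective A
  haveI := halg
  haveI : CharP (AlgebraicClosure (FractionRing A)) p := charP_of_injective_algebraMap hAL p
  haveI : PerfectField (AlgebraicClosure (FractionRing A)) :=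
    IsAlgClosed.perfectField (AlgebraicClosure (FractionRing A))
  haveI := hint
  have hY : Scheme.HasResolution (pullback f (Spec.map (CommRingCat.ofHom
      (algebraMap A (AlgebraicClosure (FractionRing A)))))) :=
    h (AlgebraicClosure (FractionRing A)) _
      (pullback.snd f (Spec.map (CommRingCat.ofHom (algebraMap A (AlgebraicClosure (FractionRing A))))))
      inferInstance inferInstance inferInstance hint hdim
  exact exists_familyResolution_datum A (AlgebraicClosure (FractionRing A)) hAL 𝒳 f hint hY

/-- **THE GRADED EQUIVALENCE.** For a prime `p` and `n : WithBot ℕ∞`: resolution of the integral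
separated finite-type schemes of dimension `≤ n` over ALL algebraically closed fields of characteristic
`p` ↔ `FamilyResolutionDimLe (AlgebraicClosure (ZMod p)) n` (family resolution over `𝔽̄_p` in fibre
dimension `≤ n`). In particular the first open grade of the family form, `n = 4`, IS resolution of
`4`-folds over algebraically closed fields of characteristic `p`. [folklore] -/
theorem forall_isAlgClosed_resUpToDim_iff_familyResolutionDimLe (p : ℕ) [Fact p.Prime] (n : WithBot ℕ∞) :
    (∀ (K : Type) [Field K] [CharP K p] [IsAlgClosed K] (X : Scheme.{0}) (f : X ⟶ Spec (.of K)),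
        IsSeparated f → LocallyOfFiniteType f → QuasiCompact f → IsIntegral X →
          topologicalKrullDim X ≤ n → Scheme.HasResolution X) ↔
      CampaignW82.FamilyResolutionDimLe (AlgebraicClosure (ZMod p)) n := by
  haveI : CharP (AlgebraicClosure (ZMod p)) p :=
    charP_of_injective_algebraMap (algebraMap (ZMod p) (AlgebraicClosure (ZMod p))).injective p
  refine ⟨fun h => familyResolutionDimLe_of_forall_isAlgClosed p n h _, fun h K _ _ _ X f hs hl hq hX hdim => ?_⟩
  letI : Algebra (ZMod p) K := ZMod.algebra K p
  let ι : AlgebraicClosure (ZMod p) →ₐ[ZMod p] K := IsAlgClosed.lift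
  letI : Algebra (AlgebraicClosure (ZMod p)) K := ι.toRingHom.toAlgebra
  exact hasResolution_of_familyResolutionDimLe (AlgebraicClosure (ZMod p)) K n h X f hdim

end Summit.ResolutionOfSingularities.ResolutionOfSingularities.Theorems.PrimeModelTransfer

end
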